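import Summits.ResolutionOfSingularities.ResolutionOfSingularities.Theorems.PinchCutKernels
import Summits.ResolutionOfSingularities.ResolutionOfSingularities.Theorems.MaxContactCutCurveLeafExit
import HarnessLib

/-!
# MaxContactCutPinchCut — the decomp-res node «PinchCut» BY NAME on the host route `MaxContactCut` (lens-2 g14 rev
1, sha256 c63212f979e09fcb;
CRITIC-LEDGER rows 97 / 100 CLEARED)

Tree file 3/3 (in the Theses cone): EXACT AT THE RUNG `rungOne_iff : MaxContactCut.RungOne ⟺ PinchGenericRung ∧
PinchSpecialRung` (29273), necessity by
letter (`pinchGenericRung_of_rungOne`, `pinchSpecialRung_of_rungOne`, `pinchSpecialRung_iff_rungOne`), `closes`,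
`closes_of_engines` (the NEW engines
(M) `MonomialPinchExit` + (C) `FlatConeExit` + g13/g12/g11/tree engines + the unchanged port `CurvePackagePort n`),
the cuts beneath
(`pinchSpecialRung_iff_iso`, `closes_of_columns`, `pinchSpecialRung_iff_leaves`, `closes_of_leaves`,
`e_one_iff_families`), the MAP EDGES to 28544
(`closes_core`) and 30461 (`closes_closedPointCore`), and §E the REFINEMENT EDGES BY NAME to g13
(`CurveLeafExit.LeafGenericRung` / `LeafSpecialRung`),
g12 (`RelativeDeltaCut.RelGenericRung` / `RelSpecialRung`), the tree asides 32106/32107 (g10), 31576/31577 (g9) and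
g11's `DeltaGenericRung` /
`DeltaSpecialRung`, with the iff's `leaf/rel/vn/ff/deltaSpecialRung_iff_pinchSpecialRung` — VERBATIM (0 sorry).
Nothing closes 29273: the DECIDED half
is `PinchGenericRung` (engines as hypotheses), the located residual `PinchSpecialRung` is superseded on the route by
the newer lens-2 residuals
(g15 `JetCut` … — ONE aside on the column, critic rulings rows 121/133).  Supports 29273.
(Sources: CossartJannsenSaito2020 Thm. 2.14, Ch. 2, Ch. 8; CossartPiltant2008 Prop. 4.2; CossartPiltant2019 Rem.
3.2; Hironaka1964 Ch. III; Moh1987; Giraud1975; ZariskiSamuelII Ch. VIII.)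
-/

open CategoryTheory AlgebraicGeometry TopologicalSpace IsLocalRing
open Literature.AlgebraicGeometry.Resolution
open Summit.ResolutionOfSingularities.ResolutionOfSingularities.Theorems
open Summit.ResolutionOfSingularities.ResolutionOfSingularities.Theorems.WeakOrderReduction
open Summit.ResolutionOfSingularities.ResolutionOfSingularities.Theorems.DeltaFaceCutClasses
open Summit.ResolutionOfSingularities.ResolutionOfSingularities.Theorems.RelativeDeltaCut
open Summit.ResolutionOfSingularities.ResolutionOfSingularities.Theorems.CurveLeafExit
open Summit.ResolutionOfSingularities.ResolutionOfSingularities.Theses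

namespace Summit.ResolutionOfSingularities.ResolutionOfSingularities.Theorems.PinchCut

section Kernels

variable {n : ℕ}

/-- **EXACT AT THE RUNG**: `RungOne ⟺ PinchGenericRung ∧ PinchSpecialRung` (marking by marking). [folklore] -/
theorem rungOne_iff : MaxContactCut.RungOne ↔ PinchGenericRung ∧ PinchSpecialRung := by
  constructor
  · intro h
    exact ⟨fun hE2 n hn => seqPGen_of_seqDimFour_one (h hE2 n hn),
      fun hE2 n hn => seqPSpec_of_seqDimFour_one (h hE2 n hn)⟩
  · rintro ⟨hG, hS⟩ hE2 n hn
    exact seqDimFour_one_iff.mpr ⟨hG hE2 n hn, hS hE2 n hn⟩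

/-- NECESSITY by letter: the decided half is implied by the rung. [folklore] -/
theorem pinchGenericRung_of_rungOne (h : MaxContactCut.RungOne) : PinchGenericRung := (rungOne_iff.mp h).1

/-- NECESSITY by letter: the located residual is implied by the rung. [folklore] -/
theorem pinchSpecialRung_of_rungOne (h : MaxContactCut.RungOne) : PinchSpecialRung := (rungOne_iff.mp h).2

/-- HONESTY KERNEL: modulo the decided half, the located residual IS the rung. [folklore] -/
theorem pinchSpecialRung_iff_rungOne (hG : PinchGenericRung) : PinchSpecialRung ↔ MaxContactCut.RungOne :=
  ⟨fun hS => rungOne_iff.mpr ⟨hG, hS⟩, pinchSpecialRung_of_rungOne⟩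

/-- **DECIDING IMPLICATION OF THE NODE**: `MaxContactCut.RungOne` (29273) BY NAME from the two halves. [folklore] -/
theorem closes (hG : PinchGenericRung) (hS : PinchSpecialRung) : MaxContactCut.RungOne :=
  rungOne_iff.mpr ⟨hG, hS⟩

/-- `RungOne` BY NAME from the seven ENGINES, the ports and the located residual. [folklore] -/
theorem closes_of_engines (hV : VeryNearCutClasses.VeryNearExit) (hD : DeltaPackageExit)
    (hU : UniformCurvePackageExit) (hR : RelCurvePackageExit) (hN : NormalConeJumpExit)
    (hM : MonomialPinchExit) (hC : FlatConeExit) (hP : ∀ n : ℕ, 2 ≤ n → CurvePackagePort n)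
    (h1 : FaceFormCutClasses.OrderOneContact) (hS : PinchSpecialRung) : MaxContactCut.RungOne :=
  closes (pinchGenericRung_of_engines hV hD hU hR hN hM hC hP h1) hS

/-- The located residual split at the rung into the two isolation columns (EXACT). [folklore] -/
theorem pinchSpecialRung_iff_iso : PinchSpecialRung ↔
    (E 2 → ∀ n : ℕ, 1 ≤ n → SeqPSpecNonIso n) ∧ (E 2 → ∀ n : ℕ, 1 ≤ n → SeqPSpecIso n) :=
  ⟨fun h => ⟨fun hE2 n hn => (seqPSpec_iff_iso.mp (h hE2 n hn)).1, fun hE2 n hn => (seqPSpec_iff_iso.mp (h hE2 n hn)).2⟩,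
    fun h hE2 n hn => seqPSpec_iff_iso.mpr ⟨h.1 hE2 n hn, h.2 hE2 n hn⟩⟩

/-- `RungOne` BY NAME from the decided half and the two isolation columns. [folklore] -/
theorem closes_of_columns (hG : PinchGenericRung) (hN : E 2 → ∀ n : ℕ, 1 ≤ n → SeqPSpecNonIso n)
    (hI : E 2 → ∀ n : ℕ, 1 ≤ n → SeqPSpecIso n) : MaxContactCut.RungOne :=
  closes hG (pinchSpecialRung_iff_iso.mpr ⟨hN, hI⟩)

/-- The located residual split at the rung into the four LEAVES (CURVE-REGULAR, CURVE-SINGULAR, TANGLE, ISO) — EXACT.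
[folklore] -/
theorem pinchSpecialRung_iff_leaves : PinchSpecialRung ↔
    (E 2 → ∀ n : ℕ, 1 ≤ n → SeqPSpecCurveReg n) ∧ (E 2 → ∀ n : ℕ, 1 ≤ n → SeqPSpecCurveSing n) ∧
      (E 2 → ∀ n : ℕ, 1 ≤ n → SeqPSpecTangle n) ∧ (E 2 → ∀ n : ℕ, 1 ≤ n → SeqPSpecIso n) := by
  constructor
  · intro h
    refine ⟨fun hE2 n hn => ?_, fun hE2 n hn => ?_, fun hE2 n hn => ?_,
      fun hE2 n hn => (seqPSpec_iff_iso.mp (h hE2 n hn)).2⟩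
    · exact (seqPSpecCurve_iff_reg.mp (seqPSpecNonIso_iff.mp (seqPSpec_iff_iso.mp (h hE2 n hn)).1).1).1
    · exact (seqPSpecCurve_iff_reg.mp (seqPSpecNonIso_iff.mp (seqPSpec_iff_iso.mp (h hE2 n hn)).1).1).2
    · exact (seqPSpecNonIso_iff.mp (seqPSpec_iff_iso.mp (h hE2 n hn)).1).2
  · rintro ⟨hR, hS, hT, hI⟩ hE2 n hn
    exact seqPSpec_of_leaves (hR hE2 n hn) (hS hE2 n hn) (hT hE2 n hn) (hI hE2 n hn)

/-- `RungOne` BY NAME from the decided half and the four leaves. [folklore] -/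
theorem closes_of_leaves (hG : PinchGenericRung) (hR : E 2 → ∀ n : ℕ, 1 ≤ n → SeqPSpecCurveReg n)
    (hS : E 2 → ∀ n : ℕ, 1 ≤ n → SeqPSpecCurveSing n) (hT : E 2 → ∀ n : ℕ, 1 ≤ n → SeqPSpecTangle n)
    (hI : E 2 → ∀ n : ℕ, 1 ≤ n → SeqPSpecIso n) : MaxContactCut.RungOne :=
  closes hG (pinchSpecialRung_iff_leaves.mpr ⟨hR, hS, hT, hI⟩)

/-- `E 1` ⟺ the two families at every marking (EXACT, family level). [folklore] -/
theorem e_one_iff_families : E 1 ↔ (∀ n : ℕ, 1 ≤ n → SeqPGen n) ∧ (∀ n : ℕ, 1 ≤ n → SeqPSpec n) :=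
  ⟨fun h => ⟨fun n hn => seqPGen_of_seqDimFour_one (h n hn), fun n hn => seqPSpec_of_seqDimFour_one (h n hn)⟩,
    fun h n hn => seqDimFour_one_iff.mpr ⟨h.1 n hn, h.2 n hn⟩⟩

/-! ### Map edges BY NAME to the tree's located residuals -/

/-- MAP EDGE to the located core `MaxContactCut.StepPICoreDimFour` (28544) BY NAME, through
`MaxContactCutTauLadder.closes`. [folklore] -/
theorem closes_core (h5 : MaxContactCutExhaustion.ContactOrderSequenceDimFour) (r4 : MaxContactCut.RungFour)
    (r3 : MaxContactCut.RungThree) (r2 : MaxContactCut.RungTwo) (hG : PinchGenericRung) (hS : PinchSpecialRung)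
    (hSS : MaxContactCut.SequenceToStepAll) : MaxContactCut.StepPICoreDimFour :=
  (MaxContactCutTauLadder.closes h5 r4 r3 r2 (closes hG hS) hSS).2.2.2.2

/-- MAP EDGE to g7's located residual `MaxContactCut.ClosedPointCoreAll` (30461) BY NAME (given the rounds, the rung IS
the closed-point core). [folklore] -/
theorem closes_closedPointCore (hE2 : E 2) (h2 : MaxContactCut.RoundCodimTwoAll)
    (h3 : MaxContactCut.RoundCodimThreeAll) (hG : PinchGenericRung) (hS : PinchSpecialRung) :
    MaxContactCut.ClosedPointCoreAll :=
  (MaxContactCutGenericPointCut.rungOne_iff_core_of_rounds hE2 h2 h3).mp (closes hG hS)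

end Kernels

section Refinement

/-! ## §E  Refinement edges BY NAME: to g13 / g12 (restated rungs), to the tree's g10 asides 32106/32107, the g9 asides
31576/31577, and the tree's g11 rungs `DeltaGenericRung` / `DeltaSpecialRung` -/

/-- **EDGE to g13**: the decided half implies g13's decided half `LeafGenericRung` (restated). [folklore] -/
theorem leafGenericRung_of_pinchGenericRung (h : PinchGenericRung) : LeafGenericRung :=
  fun hE2 n hn => seqLGen_of_seqPGen (h hE2 n hn)

/-- **EDGE to g12** (through g13's edge). [folklore] -/
theorem relGenericRung_of_pinchGenericRung (h : PinchGenericRung) : RelGenericRung :=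
  CurveLeafExit.relGenericRung_of_leafGenericRung (leafGenericRung_of_pinchGenericRung h)

/-- **EDGE to 32106**: the decided half implies the tree's g10 decided aside `VNGenericRung`. [folklore] -/
theorem vnGenericRung_of_pinchGenericRung (h : PinchGenericRung) : MaxContactCut.VNGenericRung :=
  CurveLeafExit.vnGenericRung_of_leafGenericRung (leafGenericRung_of_pinchGenericRung h)

/-- **EDGE to 31576** (through 32106). [folklore] -/
theorem ffGenericRung_of_pinchGenericRung (h : PinchGenericRung) : MaxContactCut.FFGenericRung :=
  CurveLeafExit.ffGenericRung_of_leafGenericRung (leafGenericRung_of_pinchGenericRung h)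

/-- **EDGE to the tree's g11 rung** `DeltaFaceCutClasses.DeltaGenericRung`. [folklore] -/
theorem deltaGenericRung_of_pinchGenericRung (h : PinchGenericRung) : DeltaGenericRung :=
  CurveLeafExit.deltaGenericRung_of_leafGenericRung (leafGenericRung_of_pinchGenericRung h)

/-- **EDGE from g13**: g13's located residual `LeafSpecialRung` (restated) implies this node's (the residual SHRINKS by
letter). [folklore] -/
theorem pinchSpecialRung_of_leafSpecialRung (h : LeafSpecialRung) : PinchSpecialRung :=
  fun hE2 n hn => seqPSpec_of_seqLSpec (h hE2 n hn)

/-- **EDGE from g12** (restated). [folklore] -/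
theorem pinchSpecialRung_of_relSpecialRung (h : RelSpecialRung) : PinchSpecialRung :=
  pinchSpecialRung_of_leafSpecialRung (CurveLeafExit.leafSpecialRung_of_relSpecialRung h)

/-- **EDGE from 32107**: the tree's g10 located residual `VNSpecialRung` implies this node's. [folklore] -/
theorem pinchSpecialRung_of_vnSpecialRung (h : MaxContactCut.VNSpecialRung) : PinchSpecialRung :=
  pinchSpecialRung_of_leafSpecialRung (CurveLeafExit.leafSpecialRung_of_vnSpecialRung h)

/-- **EDGE from 31577** (through the tree's g10 edge). [folklore] -/
theorem pinchSpecialRung_of_ffSpecialRung (h : MaxContactCut.FFSpecialRung) : PinchSpecialRung :=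
  pinchSpecialRung_of_leafSpecialRung (CurveLeafExit.leafSpecialRung_of_ffSpecialRung h)

/-- **EDGE from the tree's g11 rung** `DeltaFaceCutClasses.DeltaSpecialRung`. [folklore] -/
theorem pinchSpecialRung_of_deltaSpecialRung (h : DeltaSpecialRung) : PinchSpecialRung :=
  pinchSpecialRung_of_leafSpecialRung (CurveLeafExit.leafSpecialRung_of_deltaSpecialRung h)

/-- **EDGE from g13's CURVE stratum** at the rung (the stratum this node cuts). [folklore] -/
theorem pinchSpecCurve_of_leafSpecCurve (h : E 2 → ∀ n : ℕ, 1 ≤ n → SeqLSpecCurve n) :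
    E 2 → ∀ n : ℕ, 1 ≤ n → SeqPSpecCurve n :=
  fun hE2 n hn => seqPSpecCurve_of_seqLSpecCurve (h hE2 n hn)

/-- **EDGE from g11's NON-ISOLATED column** (tree) at the rung. [folklore] -/
theorem pinchSpecNonIso_of_deltaSpecNonIso (h : E 2 → ∀ n : ℕ, 1 ≤ n → SeqDSpecNonIso n) :
    E 2 → ∀ n : ℕ, 1 ≤ n → SeqPSpecNonIso n :=
  fun hE2 n hn => seqPSpecNonIso_of_seqDSpecNonIso (h hE2 n hn)

/-- HONESTY: modulo the decided half, g13's located residual and this node's are EQUIVALENT — both are the rung.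
[folklore] -/
theorem leafSpecialRung_iff_pinchSpecialRung (hG : PinchGenericRung) : LeafSpecialRung ↔ PinchSpecialRung :=
  ⟨pinchSpecialRung_of_leafSpecialRung,
    fun hS => CurveLeafExit.leafSpecialRung_of_rungOne (closes hG hS)⟩

/-- HONESTY: modulo the decided half, g12's located residual and this node's are EQUIVALENT. [folklore] -/
theorem relSpecialRung_iff_pinchSpecialRung (hG : PinchGenericRung) : RelSpecialRung ↔ PinchSpecialRung :=
  ⟨pinchSpecialRung_of_relSpecialRung,
    fun hS => (CurveLeafExit.relSpecialRung_iff_leafSpecialRung (leafGenericRung_of_pinchGenericRung hG)).mpr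
      (CurveLeafExit.leafSpecialRung_of_rungOne (closes hG hS))⟩

/-- HONESTY: modulo the decided half, the tree's g10 located residual 32107 and this node's are EQUIVALENT. [folklore] -/
theorem vnSpecialRung_iff_pinchSpecialRung (hG : PinchGenericRung) :
    MaxContactCut.VNSpecialRung ↔ PinchSpecialRung :=
  ⟨pinchSpecialRung_of_vnSpecialRung,
    fun hS => MaxContactCutVeryNearCut.nearSpecialRung_of_rungOne (closes hG hS)⟩

/-- HONESTY: modulo the decided half, the tree's g9 located residual 31577 and this node's are EQUIVALENT. [folklore] -/
theorem ffSpecialRung_iff_pinchSpecialRung (hG : PinchGenericRung) :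
    MaxContactCut.FFSpecialRung ↔ PinchSpecialRung :=
  ⟨pinchSpecialRung_of_ffSpecialRung,
    fun hS => MaxContactCutFaceFormCut.specialRung_of_rungOne (closes hG hS)⟩

/-- HONESTY: modulo the decided half, the tree's g11 located residual and this node's are EQUIVALENT. [folklore] -/
theorem deltaSpecialRung_iff_pinchSpecialRung (hG : PinchGenericRung) : DeltaSpecialRung ↔ PinchSpecialRung :=
  ⟨pinchSpecialRung_of_deltaSpecialRung,
    fun hS hE2 n hn => DeltaFaceCutKernels.seqDSpec_of_seqDimFour_one (closes hG hS hE2 n hn)⟩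

/-- `RungOne` BY NAME from the decided half and g13's located residual. [folklore] -/
theorem closes_of_leafSpecialRung (hG : PinchGenericRung) (hS : LeafSpecialRung) : MaxContactCut.RungOne :=
  closes hG (pinchSpecialRung_of_leafSpecialRung hS)

/-- `RungOne` BY NAME from the decided half and the tree's g10 located residual 32107. [folklore] -/
theorem closes_of_vnSpecialRung (hG : PinchGenericRung) (hS : MaxContactCut.VNSpecialRung) : MaxContactCut.RungOne :=
  closes hG (pinchSpecialRung_of_vnSpecialRung hS)

/-- `RungOne` BY NAME from the decided half and the tree's g9 located residual 31577. [folklore] -/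
theorem closes_of_ffSpecialRung (hG : PinchGenericRung) (hS : MaxContactCut.FFSpecialRung) : MaxContactCut.RungOne :=
  closes hG (pinchSpecialRung_of_ffSpecialRung hS)

/-- `RungOne` BY NAME from the decided half and the tree's g11 located residual. [folklore] -/
theorem closes_of_deltaSpecialRung (hG : PinchGenericRung) (hS : DeltaSpecialRung) : MaxContactCut.RungOne :=
  closes hG (pinchSpecialRung_of_deltaSpecialRung hS)

end Refinement

end Summit.ResolutionOfSingularities.ResolutionOfSingularities.Theorems.PinchCut
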